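import Mathlib

/-!
# Line `Sketch` for crux `FixedPointFreeTargets` (stmt-MatrixMultiplication-15042) —
stub `stub_target`: the universal difference target of a finite abelian group action

Let a finite abelian group `E` act on a topological space `V` (`act 0 = id`,
`act (g + h) = act g ∘ act h`, each `act g` continuous) and let `coord t : V → ℂ` (`t ∈ T`, finite)
be continuous coordinates separating points.  Put `E' = E ∖ {0}` and

* `f x = (coord t (act g x) - coord t x)_{(g,t) ∈ E' × T}`,
* `ρ_h F (g, t) = F̃ (g + h, t) - F̃ (h, t)`, where `F̃` is `F` extended by `0` at `g = 0`.

Then `ρ` is a representation of `E` on `ℂ^(E' × T)` (`ρ_0 = 1`, `ρ_(g+h) = ρ_g ρ_h`), a `ρ`-fixed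
vector is an additive map `E → ℂ^T`, hence `0` because `E` is torsion (`|E| • g = 0`), `f` is
continuous and `ρ`-equivariant, and `f x = 0` iff `x` is `E`-fixed.  Transporting along
`E' × T ≃ Fin d` gives the registered stub, the engine of the tautological target
`SmithPhaseGap → FixedPointFreeTargets` (route PauliSmithLocalisation).

References: T. tom Dieck, *Transformation Groups*, de Gruyter (1987), ch. I (elementary
equivariant maps to representation spheres); folklore.
-/

set_option linter.dupNamespace false

noncomputable section

namespace Summit.MatrixMultiplication.MatrixMultiplication.Theorems

open scoped BigOperators

namespace PauliTautologicalTarget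

/-- Extension by zero, evaluated at a non-zero point: the sum over `E ∖ {0}` of
`[c = e] · F (c, t)` is `F (e, t)`. -/
theorem extZero_apply_of_ne {E : Type} [Zero E] [Fintype E] [DecidableEq E] {T : Type}
    (F : {g : E // g ≠ 0} × T → ℂ) {e : E} (he : e ≠ 0) (t : T) :
    (∑ c : {g : E // g ≠ 0}, if (c : E) = e then F (c, t) else 0) = F (⟨e, he⟩, t) := by
  rw [Finset.sum_eq_single ⟨e, he⟩]
  · simp
  · intro c _ hc
    rw [if_neg]
    intro h
    exact hc (Subtype.ext h)
  · intro h
    exact absurd (Finset.mem_univ _) h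

/-- Extension by zero, evaluated at `0`: the sum over `E ∖ {0}` of `[c = 0] · F (c, t)` vanishes. -/
theorem extZero_apply_zero {E : Type} [Zero E] [Fintype E] [DecidableEq E] {T : Type}
    (F : {g : E // g ≠ 0} × T → ℂ) (t : T) :
    (∑ c : {g : E // g ≠ 0}, if (c : E) = 0 then F (c, t) else 0) = 0 :=
  Finset.sum_eq_zero fun c _ => if_neg c.2

/-- **Universal difference target.**  A continuous action of a finite abelian group `E` on a space
`V` with continuous point-separating coordinates `coord t` admits a representation `ρ` on some `ℂ^d`
without non-zero fixed vectors and a continuous `ρ`-equivariant `f : V → ℂ^d` vanishing only on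
`E`-fixed points (`f x = (coord t (act g x) - coord t x)_{g ≠ 0, t}`, `ρ_h F(g) = F(g+h) - F(h)`).
[cite: tomDieck1987, ch. I] -/
theorem stub_target {E : Type} [AddCommGroup E] [Fintype E] [DecidableEq E]
    {T : Type} [Fintype T] [DecidableEq T] {V : Type} [TopologicalSpace V]
    (coord : T → V → ℂ) (hcont : ∀ t, Continuous (coord t))
    (hsep : ∀ x y : V, (∀ t, coord t x = coord t y) → x = y)
    (act : E → V → V) (h0 : ∀ x, act 0 x = x)
    (hadd : ∀ g h x, act (g + h) x = act g (act h x)) (hc : ∀ g, Continuous (act g)) :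
    ∃ (d : ℕ) (ρ : E → Matrix (Fin d) (Fin d) ℂ) (f : V → Fin d → ℂ),
      ρ 0 = 1 ∧ (∀ g h, ρ (g + h) = ρ g * ρ h) ∧
      (∀ w : Fin d → ℂ, (∀ g, (ρ g).mulVec w = w) → w = 0) ∧
      Continuous f ∧ (∀ x, f x = 0 → ∀ g, act g x = x) ∧
      (∀ g x, f (act g x) = (ρ g).mulVec (f x)) := by
  -- extension by zero of `F : E' × T → ℂ` (`E' = E ∖ {0}`) to `E → T → ℂ`
  obtain ⟨ext, hext⟩ : ∃ ext : (({g : E // g ≠ 0} × T) → ℂ) → E → T → ℂ,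
      ext = fun F e t => ∑ c : {g : E // g ≠ 0}, if (c : E) = e then F (c, t) else 0 := ⟨_, rfl⟩
  have ext_ne : ∀ F {e : E} (he : e ≠ 0) t, ext F e t = F (⟨e, he⟩, t) := by
    intro F e he t
    rw [hext]
    exact extZero_apply_of_ne F he t
  have ext_zero : ∀ F t, ext F 0 t = 0 := by
    intro F t
    rw [hext]
    exact extZero_apply_zero F t
  have ext_eq : ∀ F i, F i = ext F i.1 i.2 := by
    intro F i
    obtain ⟨⟨e, he⟩, t⟩ := i
    dsimp only
    rw [ext_ne F he]
  -- the difference representation on `ℂ^(E' × T)`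
  obtain ⟨ρJ, hρJ⟩ : ∃ ρJ : E → Matrix ({g : E // g ≠ 0} × T) ({g : E // g ≠ 0} × T) ℂ,
      ρJ = fun h => Matrix.of fun i j => if i.2 = j.2 then
        ((if (j.1 : E) = (i.1 : E) + h then (1 : ℂ) else 0) - (if (j.1 : E) = h then 1 else 0))
        else 0 := ⟨_, rfl⟩
  have mulVec_eq : ∀ h F i, (ρJ h).mulVec F i = ext F (i.1 + h) i.2 - ext F h i.2 := by
    intro h F i
    rw [hρJ, hext]
    simp only [Matrix.mulVec, dotProduct, Matrix.of_apply, Fintype.sum_prod_type, ite_mul,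
      zero_mul, sub_mul, one_mul, Finset.sum_ite_eq, Finset.mem_univ, if_true,
      Finset.sum_sub_distrib]
  have ext_mulVec : ∀ h F e t, ext ((ρJ h).mulVec F) e t = ext F (e + h) t - ext F h t := by
    intro h F e t
    by_cases he : e = 0
    · subst he
      rw [ext_zero, zero_add, sub_self]
    · rw [ext_ne _ he, mulVec_eq]
  -- matrices are determined by their action on vectors
  have ext_of_mulVec : ∀ M N : Matrix ({g : E // g ≠ 0} × T) ({g : E // g ≠ 0} × T) ℂ,
      (∀ F, M.mulVec F = N.mulVec F) → M = N := by
    intro M N hMN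
    exact Matrix.toLin'.injective (LinearMap.ext fun F => by
      rw [Matrix.toLin'_apply, Matrix.toLin'_apply]; exact hMN F)
  have ρJ_zero : ρJ 0 = 1 := by
    refine ext_of_mulVec _ _ fun F => funext fun i => ?_
    rw [mulVec_eq, Matrix.one_mulVec, add_zero, ext_zero, sub_zero, ← ext_eq F i]
  have ρJ_add : ∀ g h, ρJ (g + h) = ρJ g * ρJ h := by
    intro g h
    refine ext_of_mulVec _ _ fun F => funext fun i => ?_
    rw [← Matrix.mulVec_mulVec, mulVec_eq, mulVec_eq, ext_mulVec, ext_mulVec, add_assoc]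
    ring
  -- a fixed vector is an additive map `E → ℂ^T`, hence zero (`E` is torsion)
  have ρJ_fixed : ∀ F, (∀ h, (ρJ h).mulVec F = F) → F = 0 := by
    intro F hF
    have hadd' : ∀ e h t, ext F (e + h) t = ext F e t + ext F h t := by
      intro e h t
      have key := ext_mulVec h F e t
      rw [hF h] at key
      rw [key]
      ring
    have hsmul : ∀ (n : ℕ) (e : E) t, ext F (n • e) t = (n : ℂ) * ext F e t := by
      intro n e t
      induction n with
      | zero => rw [zero_nsmul, ext_zero, Nat.cast_zero, zero_mul]
      | succ n ih => rw [add_nsmul, one_nsmul, hadd', ih, Nat.cast_succ]; ring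
    have hzero : ∀ e t, ext F e t = 0 := by
      intro e t
      have h1 := hsmul (Fintype.card E) e t
      rw [card_nsmul_eq_zero, ext_zero] at h1
      have hcard : (Fintype.card E : ℂ) ≠ 0 := Nat.cast_ne_zero.2 Fintype.card_ne_zero
      exact (mul_eq_zero.1 h1.symm).resolve_left hcard
    funext i
    rw [ext_eq F i, hzero]
    rfl
  -- the target `f x = (coord t (act g x) - coord t x)_{g ≠ 0, t}`
  obtain ⟨G, hG⟩ : ∃ G : V → E → T → ℂ, G = fun x g t => coord t (act g x) - coord t x :=
    ⟨_, rfl⟩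
  obtain ⟨fJ, hfJ⟩ : ∃ fJ : V → ({g : E // g ≠ 0} × T) → ℂ, fJ = fun x i => G x i.1 i.2 :=
    ⟨_, rfl⟩
  have G_zero : ∀ x t, G x 0 t = 0 := by
    intro x t
    rw [hG]
    simp [h0]
  have ext_fJ : ∀ x e t, ext (fJ x) e t = G x e t := by
    intro x e t
    by_cases he : e = 0
    · subst he
      rw [ext_zero, G_zero]
    · rw [ext_ne _ he]
      simp only [hfJ]
  have fJ_cont : Continuous fJ := by
    rw [hfJ, hG]
    exact continuous_pi fun i => ((hcont i.2).comp (hc i.1)).sub (hcont i.2)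
  have fJ_zero : ∀ x, fJ x = 0 → ∀ g, act g x = x := by
    intro x hx g
    by_cases hg : g = 0
    · subst hg
      exact h0 x
    · refine hsep _ _ fun t => ?_
      have key := congrFun hx (⟨g, hg⟩, t)
      rw [hfJ, hG] at key
      simp only [Pi.zero_apply] at key
      exact sub_eq_zero.1 key
  have fJ_equiv : ∀ g x, fJ (act g x) = (ρJ g).mulVec (fJ x) := by
    intro g x
    funext i
    rw [mulVec_eq, ext_fJ, ext_fJ]
    have key : fJ (act g x) i = G (act g x) i.1 i.2 := by rw [hfJ]
    rw [key, hG]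
    simp only
    rw [← hadd]
    ring
  -- transport to `Fin d` along `E' × T ≃ Fin d`
  obtain ⟨e, -⟩ : ∃ _ : ({g : E // g ≠ 0} × T) ≃ Fin (Fintype.card ({g : E // g ≠ 0} × T)),
      True := ⟨Fintype.equivFin _, trivial⟩
  have hcomp : ∀ F : ({g : E // g ≠ 0} × T) → ℂ, ((fun i => F (e.symm i)) ∘ e) = F :=
    fun F => funext fun j => by simp
  refine ⟨Fintype.card ({g : E // g ≠ 0} × T), fun g => (ρJ g).submatrix e.symm e.symm,
    fun x i => fJ x (e.symm i), ?_, ?_, ?_, ?_, ?_, ?_⟩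
  · show (ρJ 0).submatrix e.symm e.symm = 1
    rw [ρJ_zero, Matrix.submatrix_one_equiv]
  · intro g h
    show (ρJ (g + h)).submatrix e.symm e.symm =
      (ρJ g).submatrix e.symm e.symm * (ρJ h).submatrix e.symm e.symm
    rw [ρJ_add, Matrix.submatrix_mul_equiv]
  · intro w hw
    have hF : (w ∘ e) = 0 := by
      refine ρJ_fixed _ fun g => funext fun j => ?_
      have hj := congrFun (hw g) (e j)
      rw [Matrix.submatrix_mulVec_equiv] at hj
      simpa using hj
    funext i
    have hi := congrFun hF (e.symm i)
    simpa using hi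
  · exact continuous_pi fun i => (continuous_apply (e.symm i)).comp fJ_cont
  · intro x hx
    refine fJ_zero x (funext fun j => ?_)
    have hj := congrFun hx (e j)
    simpa using hj
  · intro g x
    funext i
    simp only [Matrix.submatrix_mulVec_equiv, Function.comp_apply, Equiv.symm_symm, hcomp,
      fJ_equiv]

end PauliTautologicalTarget

end Summit.MatrixMultiplication.MatrixMultiplication.Theorems

end
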